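import Mathlib
import HarnessLib
import Literature.Algebra.Polynomial.LacunaryBivariateOnLine
import Summits.ValiantsHypothesis.ValiantsHypothesis.Theorems.LacunarySymmetroidMatrixDescartesStubVLawTwo

/-!
# ValiantsHypothesis / LacunarySymmetroid — crux `MatrixDescartes` (stmt-ValiantsHypothesis-18050, V1),
# LINE (A) «product_plus_one»: the SHARP SECTOR for GENERAL `K` — part 1, COEFFICIENTS AND LEVEL BUDGETS

A `K`-nomial `f = Σ_{i<K} c_i X^{d_i}` (`d` strictly increasing, all `c_i ≠ 0`) has `V(f) ≤ K − 1` sign variations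
(`signVariations_sparse_le`), and `≤ K − 2` as soon as two ADJACENT coefficients share a sign (`signVariations_sparse_le_of_adj`,
induction on the top term with `signVariations_C_mul_X_pow_add` of `Literature…LacunaryBivariateOnLine`).  Consequently a DESCARTES-SHARP
`K`-nomial (`K − 1` distinct positive zeros) has strictly ALTERNATING coefficients (`alternating_of_sharp`, Mathlib's
`roots_countP_pos_le_signVariations`), and its Euler transforms `θf − μf = Σ c_i (d_i − μ) X^{d_i}` (`euler_sparse`) obey the LEVEL
BUDGETS `V ≤ K − 2` for `d_i < μ < d_{i+1}` (`levelBudget_inner`) and `V ≤ K − 1` always — the combinatorial half of the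
«log-scale Laguerre inequality for sharp fewnomials» (val-lit-p7 g14 memo §13; val-v1x-eng-10's level budget), whose analytic half and
the resulting all-sharp sector `Z₊ ≤ 2((K−1)m + 1)` for EVERY format `(m, K)` follow in parts 2–3.

HONEST FRAMING: coefficient bookkeeping; NOT `stub_classRowK3`, not `stub_polyLaw`, not `ProductPlusOneMDR`, not `MatrixDescartes`, not
Conjecture B; `VP ≠ VNP` is NOT proved.  No definitions, no named facts; Mathlib + one Literature file + one tree file.
-/

-- `Summit.ValiantsHypothesis.ValiantsHypothesis.…` is the tree's mandated single-conjunct layout (Sub = Summit).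
set_option linter.dupNamespace false

namespace Summit.ValiantsHypothesis.ValiantsHypothesis.Theorems.LacunarySymmetroidMatrixDescartes

namespace ProductPlusOne

open Polynomial Finset
open scoped BigOperators

/-! ### Degree and leading coefficient of a sparse sum -/

/-- The sparse sum `Σ_{i<K} c_i X^{d_i}` has degree `< d_K` (`d` strictly increasing). [folklore] -/
theorem sparse_degree_lt (K : ℕ) (d : ℕ → ℕ) (hd : StrictMono d) (c : ℕ → ℝ) :
    (∑ i ∈ Finset.range K, C (c i) * X ^ (d i) : ℝ[X]).degree < d K := by
  refine (degree_sum_le _ _).trans_lt ?_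
  rw [Finset.sup_lt_iff (WithBot.bot_lt_coe _)]
  intro i hi
  refine (degree_C_mul_X_pow_le _ _).trans_lt ?_
  exact_mod_cast hd (Finset.mem_range.mp hi)

/-- Leading coefficient and non-vanishing of `Σ_{i ≤ K} c_i X^{d_i}` when `c_K ≠ 0`. [folklore] -/
theorem sparse_leadingCoeff (K : ℕ) (d : ℕ → ℕ) (hd : StrictMono d) (c : ℕ → ℝ) (hc : c K ≠ 0) :
    (∑ i ∈ Finset.range (K + 1), C (c i) * X ^ (d i) : ℝ[X]).leadingCoeff = c K ∧
      (∑ i ∈ Finset.range (K + 1), C (c i) * X ^ (d i) : ℝ[X]) ≠ 0 := by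
  have hlt : (∑ i ∈ Finset.range K, C (c i) * X ^ (d i) : ℝ[X]).degree < (C (c K) * X ^ (d K)).degree := by
    rw [degree_C_mul_X_pow _ hc]
    exact sparse_degree_lt K d hd c
  have hlc : (∑ i ∈ Finset.range (K + 1), C (c i) * X ^ (d i) : ℝ[X]).leadingCoeff = c K := by
    rw [Finset.sum_range_succ, add_comm, leadingCoeff_add_of_degree_lt' hlt, leadingCoeff_C_mul_X_pow]
  refine ⟨hlc, fun h => hc ?_⟩
  rw [← hlc, h, leadingCoeff_zero]

/-! ### Sign variations of a sparse sum -/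

/-- Peeling the top term: `V(Σ_{i ≤ K+1}) = V(Σ_{i ≤ K}) + [sign c_{K+1} = −sign c_K]`. [folklore] -/
theorem signVariations_sparse_succ (K : ℕ) (d : ℕ → ℕ) (hd : StrictMono d) (c : ℕ → ℝ) (hcK : c K ≠ 0)
    (hcK1 : c (K + 1) ≠ 0) :
    (∑ i ∈ Finset.range (K + 2), C (c i) * X ^ (d i) : ℝ[X]).signVariations
      = (∑ i ∈ Finset.range (K + 1), C (c i) * X ^ (d i) : ℝ[X]).signVariations
        + if SignType.sign (c (K + 1)) = -SignType.sign (c K) then 1 else 0 := by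
  rw [Finset.sum_range_succ _ (K + 1), add_comm, Literature.Algebra.Polynomial.signVariations_C_mul_X_pow_add hcK1 (sparse_degree_lt (K + 1) d hd c),
    (sparse_leadingCoeff K d hd c hcK).1]

/-- **`V ≤ K − 1`**: a sum of `K + 1` nonzero sparse terms has at most `K` sign variations. [folklore] -/
theorem signVariations_sparse_le (K : ℕ) (d : ℕ → ℕ) (hd : StrictMono d) (c : ℕ → ℝ) (hc : ∀ i, i < K + 1 → c i ≠ 0) :
    (∑ i ∈ Finset.range (K + 1), C (c i) * X ^ (d i) : ℝ[X]).signVariations ≤ K := by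
  induction K with
  | zero =>
    rw [Finset.sum_range_one, C_mul_X_pow_eq_monomial, signVariations_monomial]
  | succ K ih =>
    rw [signVariations_sparse_succ K d hd c (hc K (by omega)) (hc (K + 1) (by omega))]
    have h1 := ih (fun i hi => hc i (by omega))
    split_ifs <;> omega

/-- **`V ≤ K − 2` with a same-sign adjacency**: if `c_i c_{i+1} > 0` for some adjacent pair then a sum of `K + 2` nonzero sparse terms
has at most `K` sign variations. [folklore] -/
theorem signVariations_sparse_le_of_adj (K : ℕ) (d : ℕ → ℕ) (hd : StrictMono d) (c : ℕ → ℝ)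
    (hc : ∀ i, i < K + 2 → c i ≠ 0) (i : ℕ) (hi : i + 1 < K + 2) (hsame : 0 < c i * c (i + 1)) :
    (∑ j ∈ Finset.range (K + 2), C (c j) * X ^ (d j) : ℝ[X]).signVariations ≤ K := by
  induction K generalizing i with
  | zero =>
    have hi0 : i = 0 := by omega
    subst hi0
    rw [show (0 : ℕ) + 2 = 0 + 1 + 1 by rfl, signVariations_sparse_succ 0 d hd c (hc 0 (by omega)) (hc 1 (by omega)),
      Finset.sum_range_one, C_mul_X_pow_eq_monomial, signVariations_monomial]
    have hs : SignType.sign (c (0 + 1)) ≠ -SignType.sign (c 0) := by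
      intro h
      rcases lt_or_gt_of_ne (hc 0 (by omega)) with h0 | h0
      · have h1 : c (0 + 1) < 0 := by nlinarith
        rw [sign_neg h1, sign_neg h0] at h
        exact absurd h (by decide)
      · have h1 : 0 < c (0 + 1) := by nlinarith
        rw [sign_pos h1, sign_pos h0] at h
        exact absurd h (by decide)
    rw [if_neg hs]
  | succ K ih =>
    rw [show K + 1 + 2 = (K + 1) + 1 + 1 by rfl,
      signVariations_sparse_succ (K + 1) d hd c (hc (K + 1) (by omega)) (hc (K + 2) (by omega))]
    by_cases htop : i = K + 1
    · subst htop
      have hs : SignType.sign (c (K + 1 + 1)) ≠ -SignType.sign (c (K + 1)) := by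
        intro h
        rcases lt_or_gt_of_ne (hc (K + 1) (by omega)) with h0 | h0
        · have h1 : c (K + 1 + 1) < 0 := by nlinarith
          rw [sign_neg h1, sign_neg h0] at h
          exact absurd h (by decide)
        · have h1 : 0 < c (K + 1 + 1) := by nlinarith
          rw [sign_pos h1, sign_pos h0] at h
          exact absurd h (by decide)
      rw [if_neg hs, add_zero]
      exact signVariations_sparse_le (K + 1) d hd c (fun j hj => hc j (by omega))
    · have h1 := ih (fun j hj => hc j (by omega)) i (by omega) hsame
      rw [show K + 1 + 1 = K + 2 from rfl]
      split_ifs <;> omega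

/-! ### Sharpness forces alternation -/

/-- **A Descartes-sharp `K`-nomial alternates**: if `Σ_{i ≤ K} c_i X^{d_i}` (all `c_i ≠ 0`) has at least `K` distinct positive zeros,
then `c_i c_{i+1} < 0` for every adjacent pair. [folklore] -/
theorem alternating_of_sharp (K : ℕ) (d : ℕ → ℕ) (hd : StrictMono d) (c : ℕ → ℝ) (hc : ∀ i, i < K + 1 → c i ≠ 0)
    (hroots : K ≤ ((∑ i ∈ Finset.range (K + 1), C (c i) * X ^ (d i) : ℝ[X]).roots.toFinset.filter (fun t => 0 < t)).card)
    (i : ℕ) (hi : i + 1 < K + 1) : c i * c (i + 1) < 0 := by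
  rcases lt_trichotomy (c i * c (i + 1)) 0 with h | h | h
  · exact h
  · exact absurd h (mul_ne_zero (hc i (by omega)) (hc (i + 1) hi))
  · exfalso
    obtain ⟨K', rfl⟩ : ∃ K', K = K' + 1 := ⟨K - 1, by omega⟩
    have hV := signVariations_sparse_le_of_adj K' d hd c hc i hi h
    have hD := (StubVLawTwo.card_filter_pos_le_countP
      (∑ i ∈ Finset.range (K' + 2), C (c i) * X ^ (d i) : ℝ[X])).trans (roots_countP_pos_le_signVariations _)
    rw [show K' + 1 + 1 = K' + 2 from rfl] at hroots
    omega

/-! ### Euler transforms and the level budgets -/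

/-- `X·f′ − μ·f = Σ c_i (d_i − μ) X^{d_i}` for a sparse sum. [folklore] -/
theorem euler_sparse (K : ℕ) (d : ℕ → ℕ) (c : ℕ → ℝ) (μ : ℝ) :
    X * derivative (∑ i ∈ Finset.range K, C (c i) * X ^ (d i) : ℝ[X]) - C μ * ∑ i ∈ Finset.range K, C (c i) * X ^ (d i)
      = ∑ i ∈ Finset.range K, C (c i * ((d i : ℝ) - μ)) * X ^ (d i) := by
  ext n
  rw [coeff_sub, coeff_C_mul, finsetSum_coeff, finsetSum_coeff]
  have hX : (X * derivative (∑ i ∈ Finset.range K, C (c i) * X ^ (d i) : ℝ[X])).coeff n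
      = (n : ℝ) * (∑ i ∈ Finset.range K, C (c i) * X ^ (d i) : ℝ[X]).coeff n := by
    cases n with
    | zero => rw [coeff_X_mul_zero]; push_cast; ring
    | succ n =>
      rw [coeff_X_mul, coeff_derivative]
      push_cast
      ring
  rw [hX, finsetSum_coeff, Finset.mul_sum, Finset.mul_sum, ← Finset.sum_sub_distrib]
  refine Finset.sum_congr rfl (fun i _ => ?_)
  rw [coeff_C_mul_X_pow, coeff_C_mul_X_pow]
  split_ifs with h
  · rw [h]; ring
  · ring

/-- **Inner level budget**: for an alternating `(K+2)`-nomial and a generic level `d_i < μ < d_{i+1}`, `V(θf − μf) ≤ K`.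
[this file's theorem] -/
theorem levelBudget_inner (K : ℕ) (d : ℕ → ℕ) (hd : StrictMono d) (c : ℕ → ℝ)
    (halt : ∀ j, j + 1 < K + 2 → c j * c (j + 1) < 0) (μ : ℝ) (hgen : ∀ j, j < K + 2 → (d j : ℝ) ≠ μ)
    (i : ℕ) (hi : i + 1 < K + 2) (hμ1 : (d i : ℝ) < μ) (hμ2 : μ < d (i + 1)) :
    (∑ j ∈ Finset.range (K + 2), C (c j * ((d j : ℝ) - μ)) * X ^ (d j) : ℝ[X]).signVariations ≤ K := by
  have hc : ∀ j, j < K + 2 → c j ≠ 0 := by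
    intro j hj
    rcases Nat.lt_or_ge (j + 1) (K + 2) with h | h
    · exact fun h0 => (halt j h).ne (by rw [h0, zero_mul])
    · have hj1 : j = K + 1 := by omega
      subst hj1
      intro h0
      exact (halt K (by omega)).ne (by rw [h0, mul_zero])
  refine signVariations_sparse_le_of_adj K d hd (fun j => c j * ((d j : ℝ) - μ))
    (fun j hj => mul_ne_zero (hc j hj) (sub_ne_zero.mpr (hgen j hj))) i hi ?_
  have h1 : (d i : ℝ) - μ < 0 := by linarith
  have h2 : 0 < (d (i + 1) : ℝ) - μ := by linarith
  have h3 := halt i hi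
  nlinarith [mul_pos (neg_pos.mpr h1) h2, h3]

/-- **Outer level budget**: for any `(K+1)`-nomial with nonzero coefficients and a generic level, `V(θf − μf) ≤ K`. [folklore] -/
theorem levelBudget_outer (K : ℕ) (d : ℕ → ℕ) (hd : StrictMono d) (c : ℕ → ℝ) (hc : ∀ j, j < K + 1 → c j ≠ 0) (μ : ℝ)
    (hgen : ∀ j, j < K + 1 → (d j : ℝ) ≠ μ) :
    (∑ j ∈ Finset.range (K + 1), C (c j * ((d j : ℝ) - μ)) * X ^ (d j) : ℝ[X]).signVariations ≤ K :=
  signVariations_sparse_le K d hd (fun j => c j * ((d j : ℝ) - μ))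
    (fun j hj => mul_ne_zero (hc j hj) (sub_ne_zero.mpr (hgen j hj)))

end ProductPlusOne

end Summit.ValiantsHypothesis.ValiantsHypothesis.Theorems.LacunarySymmetroidMatrixDescartes
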